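import Summits.QuantumFields.YangMills.Theorems.ColdStartUniversalityShenZhuZhuRiemannDistComparisonSU2
import Summits.QuantumFields.YangMills.Theorems.ColdStartUniversalityLatticeLangevinBakryEmeryGradientBound
import HarnessLib

/-!
# From the coordinate carré du champ to a LIPSCHITZ BOUND IN SHEN–ZHU–ZHU'S RIEMANNIAN METRIC `ρ_L`:
# `|F(Q') − F(Q)| ≤ √(sup Γ^A(f)/2) · ρ_L(Q,Q')` along the product geodesic `s ↦ (e^{sX_e} Q_e)_e` of `SU(2)^E`

Seat `ym-line-csu-p1` (g41), route `ColdStartUniversality` of `Summits/QuantumFields/YangMills`, helper file G42 (`--supports stmt-QuantumFields-24809`).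
The seat's Bakry–Émery files (g25–g29) speak the coordinate carré du champ `Γ^A(f)(V) = Σ_(ij) ∂_if ∂_jf A_(ij)(V)` of a function `f` of the
real link coordinates (`A` the noise covariance of the SZZ dynamics; `Γ^A = 2|∇F|²` for the Hilbert–Schmidt bi-invariant metric); the Literature's
named facts `shenZhuZhu_finiteVolumeErgodicity` / `shenZhuZhu_weightedContraction` speak the Riemannian distance `ρ_L² = Σ_e ρ(Q_e,Q'_e)²`
(`torusRiemannDistSq`, in closed form on `SU(2)` by G40/G41).  This file is the bridge:

* ★ `frame_cauchySchwarz_two` — for `X_e ∈ 𝔰𝔲(2)` and any linear functional `Λ` of the coordinates: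
  `Λ(coords of (X_e Q_e)_e)² ≤ (Σ_e |X_e|²/2) · Σ_n Λ(σ_n(Q))²`, `σ_n = √2·𝐩(E_ν)Q_e` the noise frame (Parseval in `M₂(ℂ)`: `X_e = Σ_ν ⟨X_e,E_ν⟩𝐩(E_ν)`);
* ★ `carre_eq_sum_sq_frame_two` — `Γ^A(f)(V) = Σ_n (Df(coords V)[σ_n(V)])²`;
* ★★★ `abs_sub_le_sqrt_carre_mul_sqrt_torusRiemannDistSq` — **if `Γ^A(f) ≤ σ²` on `SU(2)^E` then `|f(coords Q') − f(coords Q)| ≤ √(σ²/2)·ρ_L(Q,Q')`**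
  for every differentiable `f` and all `Q, Q'` (mean value inequality along the minimal product geodesic `s ↦ (e^{sX_e}Q_e)_e`, `X_e` the minimal
  logarithms of G40, `Σ_e|X_e|² = ρ_L²`).

THEOREMS ONLY, no definition, no sorry.  HONEST FRAMING: fixed-cut-off differential geometry on `SU(2)^E`; the `W₂` contraction (4.5) is NOT proved;
nothing `K`-uniform along the route's scaling (`UniformColdStartMixing`, 24809, ASIDE, not restated); no crux, rung or summit statement is proved;
the Yang–Mills mass gap is NOT proved.

References: H. Shen, R. Zhu, X. Zhu, CMP 400 (2023) 805–851 = arXiv:2204.12737, §2 (2.3), §3 (1.6), §4.1 [ShenZhuZhu2022]; D. Bakry, I. Gentil,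
M. Ledoux, Grundlehren 348 (2014), §1.11, (3.2.4) (`Γ(f) = |∇f|²`, Lipschitz seminorm `= ‖√Γ(f)‖_∞`) [BakryGentilLedoux2014].
-/

set_option autoImplicit false

noncomputable section

namespace Summit.QuantumFields.YangMills.Theorems.ColdStartUniversality

open MeasureTheory Matrix Complex Finset Filter Topology Set
open scoped ComplexConjugate BigOperators Real
open Literature.MathematicalPhysics.QuantumFieldTheory
open Literature.MathematicalPhysics.QuantumLattice (fundamentalRep fundamentalLatticeRep continuous_fundamentalRep fundamentalRep_apply fundamentalLatticeRep_N)

variable {L : ℕ} [NeZero L]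

/-! ## §1. Parseval in `M₂(ℂ)` along the noise frame: a Cauchy–Schwarz inequality for linear functionals of the coordinates -/

/-- For `X ∈ 𝔰𝔲(2)`: `X = Σ_ν ⟨X, E_ν⟩ 𝐩(E_ν)` (Parseval for the orthonormal basis `(E_ν)` of `M₂(ℂ)` and `𝐩X = X`). [folklore] -/
theorem eq_sum_hsForm_smul_lieProj_of_mem_lieAlg_two {X : Matrix (Fin (fundamentalLatticeRep 2).N) (Fin (fundamentalLatticeRep 2).N) ℂ}
    (hX : X ∈ (fundamentalLatticeRep 2).lieAlg) :
    X = ∑ m : NoiseIdx (fundamentalLatticeRep 2).N, hsForm (fundamentalLatticeRep 2).N X (noiseDir m) • (fundamentalLatticeRep 2).lieProj (noiseDir m) := by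
  have h := congrArg (fundamentalLatticeRep 2).lieProj (sum_hsForm_noiseDir_smul (N := (fundamentalLatticeRep 2).N) X)
  rw [map_sum] at h
  simp_rw [map_smul] at h
  rw [(fundamentalLatticeRep 2).lieProj_of_mem hX] at h
  exact h.symm

/-- ★ **Frame Cauchy–Schwarz.**  For a configuration `V ∈ SU(2)^E`, directions `X_e ∈ 𝔰𝔲(2)` and any real linear functional `Λ` of the real link
coordinates: `Λ(coords of (X_e V_e)_e)² ≤ (Σ_e |X_e|²/2) · Σ_(e,ν) Λ(coords of δ_e(√2 𝐩(E_ν) V_e))²`. [cite: ShenZhuZhu2022, §2 (2.3)] -/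
theorem frame_cauchySchwarz_two (V : GaugeConfig 3 L (Matrix.specialUnitaryGroup (Fin 2) ℂ)) (X : Edge 3 L → Matrix (Fin (fundamentalLatticeRep 2).N) (Fin (fundamentalLatticeRep 2).N) ℂ)
    (hX : ∀ e, X e ∈ (fundamentalLatticeRep 2).lieAlg) (Λ : (Edge 3 L × Fin (fundamentalLatticeRep 2).N × Fin (fundamentalLatticeRep 2).N × Bool → ℝ) →L[ℝ] ℝ) :
    (Λ (fun q : Edge 3 L × Fin (fundamentalLatticeRep 2).N × Fin (fundamentalLatticeRep 2).N × Bool => (fun z : ℂ => if q.2.2.2 then z.im else z.re)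
        ((X q.1 * (fundamentalLatticeRep 2).ρ (V q.1)) q.2.1 q.2.2.1))) ^ 2 ≤
      (∑ e : Edge 3 L, hsForm (fundamentalLatticeRep 2).N (X e) (X e)) / 2 *
        ∑ n : Edge 3 L × NoiseIdx (fundamentalLatticeRep 2).N, (Λ (fun q : Edge 3 L × Fin (fundamentalLatticeRep 2).N × Fin (fundamentalLatticeRep 2).N × Bool => if n.1 = q.1 then
          (fun z : ℂ => if q.2.2.2 then z.im else z.re) (((Real.sqrt 2 : ℂ) • ((fundamentalLatticeRep 2).lieProj (noiseDir n.2) *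
            (fundamentalLatticeRep 2).ρ (V q.1))) q.2.1 q.2.2.1) else 0)) ^ 2 := by
  classical
  set v : Edge 3 L × Fin (fundamentalLatticeRep 2).N × Fin (fundamentalLatticeRep 2).N × Bool → ℝ := fun q => (fun z : ℂ => if q.2.2.2 then z.im else z.re)
    ((X q.1 * (fundamentalLatticeRep 2).ρ (V q.1)) q.2.1 q.2.2.1) with hv
  set w : Edge 3 L × NoiseIdx (fundamentalLatticeRep 2).N → (Edge 3 L × Fin (fundamentalLatticeRep 2).N × Fin (fundamentalLatticeRep 2).N × Bool → ℝ) := fun n q =>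
    if n.1 = q.1 then (fun z : ℂ => if q.2.2.2 then z.im else z.re) (((Real.sqrt 2 : ℂ) • ((fundamentalLatticeRep 2).lieProj (noiseDir n.2) *
      (fundamentalLatticeRep 2).ρ (V q.1))) q.2.1 q.2.2.1) else 0 with hw
  set c : Edge 3 L × NoiseIdx (fundamentalLatticeRep 2).N → ℝ := fun n => hsForm (fundamentalLatticeRep 2).N (X n.1) (noiseDir n.2) / Real.sqrt 2 with hc
  have h2 : (0 : ℝ) < Real.sqrt 2 := Real.sqrt_pos.2 (by norm_num)
  -- the expansion of the velocity along the frame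
  have hexp : v = ∑ n, c n • w n := by
    funext q
    obtain ⟨e, a, b, flag⟩ := q
    rw [Finset.sum_apply]
    simp only [Pi.smul_apply, smul_eq_mul]
    rw [Fintype.sum_prod_type]
    -- collapse the edge sum
    have hcol : ∀ m : NoiseIdx (fundamentalLatticeRep 2).N, ∑ e' : Edge 3 L, c (e', m) * w (e', m) (e, a, b, flag) =
        c (e, m) * (fun z : ℂ => if flag then z.im else z.re) (((Real.sqrt 2 : ℂ) • ((fundamentalLatticeRep 2).lieProj (noiseDir m) *
          (fundamentalLatticeRep 2).ρ (V e))) a b) := by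
      intro m
      rw [Finset.sum_eq_single e]
      · simp only [hw, if_true]
      · intro e' _ hne
        simp only [hw, if_neg hne, mul_zero]
      · intro h; exact absurd (Finset.mem_univ e) h
    rw [Finset.sum_comm]
    simp_rw [hcol]
    -- the left-hand side through the expansion of `X e`
    have hXe := eq_sum_hsForm_smul_lieProj_of_mem_lieAlg_two (hX e)
    have hentry : (X e * (fundamentalLatticeRep 2).ρ (V e)) a b =
        ∑ m : NoiseIdx (fundamentalLatticeRep 2).N, (hsForm (fundamentalLatticeRep 2).N (X e) (noiseDir m) : ℂ) *
          (((fundamentalLatticeRep 2).lieProj (noiseDir m) * (fundamentalLatticeRep 2).ρ (V e)) a b) := by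
      conv_lhs => rw [hXe]
      rw [Finset.sum_mul, Matrix.sum_apply]
      refine Finset.sum_congr rfl fun m _ => ?_
      rw [Matrix.smul_mul, Matrix.smul_apply, Complex.real_smul]
    simp only [hv]
    rw [hentry]
    cases flag
    · simp only [Bool.false_eq_true, if_false, Complex.re_sum, Complex.re_ofReal_mul, Matrix.smul_apply, smul_eq_mul, hc]
      refine Finset.sum_congr rfl fun m _ => ?_
      field_simp
    · simp only [if_true, Complex.im_sum, Complex.im_ofReal_mul, Matrix.smul_apply, smul_eq_mul, hc]
      refine Finset.sum_congr rfl fun m _ => ?_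
      field_simp
  -- `Λ v = Σ c_n Λ(w_n)` and Cauchy–Schwarz
  have hΛ : Λ v = ∑ n, c n * Λ (w n) := by
    rw [hexp, map_sum]
    refine Finset.sum_congr rfl fun n _ => ?_
    rw [map_smul, smul_eq_mul]
  have hCS := Finset.sum_mul_sq_le_sq_mul_sq Finset.univ c (fun n => Λ (w n))
  have hc2 : ∑ n, c n ^ 2 = (∑ e : Edge 3 L, hsForm (fundamentalLatticeRep 2).N (X e) (X e)) / 2 := by
    rw [Fintype.sum_prod_type, Finset.sum_div]
    refine Finset.sum_congr rfl fun e _ => ?_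
    simp only [hc, div_pow, Real.sq_sqrt (by norm_num : (0:ℝ) ≤ 2)]
    rw [← Finset.sum_div, sum_hsForm_noiseDir_sq]
  rw [hΛ, ← hc2]
  exact hCS

/-! ## §2. The carré du champ as a sum of squares along the frame -/

/-- ★ **`Γ^A(f)(V) = Σ_n (Df(coords V)[σ_n(V)])²`** with the frame vectors written through the group elements `V_e`. [cite: ShenZhuZhu2022, §3 (1.6)] -/
theorem carre_eq_sum_sq_frame_two (β' : ℝ) (f : (Edge 3 L × Fin 2 × Fin 2 × Bool → ℝ) → ℝ) (V : GaugeConfig 3 L (Matrix.specialUnitaryGroup (Fin 2) ℂ)) :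
    let coords : GaugeConfig 3 L (Matrix.specialUnitaryGroup (Fin 2) ℂ) → (Edge 3 L × Fin 2 × Fin 2 × Bool → ℝ) :=
      fun V q => (fun z : ℂ => if q.2.2.2 then z.im else z.re)
        ((fundamentalRep (Fin 2) (V q.1) : Matrix (Fin 2) (Fin 2) ℂ) q.2.1 q.2.2.1)
    let A : GaugeConfig 3 L (Matrix.specialUnitaryGroup (Fin 2) ℂ) → (Edge 3 L × Fin 2 × Fin 2 × Bool) →
        (Edge 3 L × Fin 2 × Fin 2 × Bool) → ℝ := fun V i j =>
      ∑ n : Edge 3 L × NoiseIdx 2,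
        (if n.1 = i.1 then (fun z : ℂ => if i.2.2.2 then z.im else z.re)
          ((latticeLangevinDynamics (fundamentalLatticeRep 2) β').noise
            (matrixConfig (fundamentalRep (Fin 2)) V) i.1 n.2 i.2.1 i.2.2.1) else 0) *
        (if n.1 = j.1 then (fun z : ℂ => if j.2.2.2 then z.im else z.re)
          ((latticeLangevinDynamics (fundamentalLatticeRep 2) β').noise
            (matrixConfig (fundamentalRep (Fin 2)) V) j.1 n.2 j.2.1 j.2.2.1) else 0)
    (∑ i : Edge 3 L × Fin 2 × Fin 2 × Bool, ∑ j : Edge 3 L × Fin 2 × Fin 2 × Bool,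
        fderiv ℝ f (coords V) (Pi.single i 1) * fderiv ℝ f (coords V) (Pi.single j 1) * A V i j) =
      ∑ n : Edge 3 L × NoiseIdx (fundamentalLatticeRep 2).N, (fderiv ℝ f (coords V) (fun q : Edge 3 L × Fin (fundamentalLatticeRep 2).N × Fin (fundamentalLatticeRep 2).N × Bool =>
        if n.1 = q.1 then (fun z : ℂ => if q.2.2.2 then z.im else z.re) (((Real.sqrt 2 : ℂ) • ((fundamentalLatticeRep 2).lieProj (noiseDir n.2) *
          (fundamentalLatticeRep 2).ρ (V q.1))) q.2.1 q.2.2.1) else 0)) ^ 2 := by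
  intro coords A
  classical
  set σ : (Edge 3 L × Fin 2 × Fin 2 × Bool) → (Edge 3 L × NoiseIdx 2) → ℝ := fun i n =>
    if n.1 = i.1 then (fun z : ℂ => if i.2.2.2 then z.im else z.re)
      ((latticeLangevinDynamics (fundamentalLatticeRep 2) β').noise (matrixConfig (fundamentalRep (Fin 2)) V) i.1 n.2 i.2.1 i.2.2.1) else 0 with hσ
  have hAV : ∀ i j, A V i j = ∑ n, σ i n * σ j n := fun i j => rfl
  simp_rw [hAV]
  rw [sum_sum_mul_mul_noiseCov_eq_sum_mul (fun i => fderiv ℝ f (coords V) (Pi.single i 1)) (fun j => fderiv ℝ f (coords V) (Pi.single j 1)) σ]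
  change ∑ n : Edge 3 L × NoiseIdx (fundamentalLatticeRep 2).N, _ = _
  refine Finset.sum_congr rfl fun n _ => ?_
  have hσn : (fun i => σ i n) = (fun q : Edge 3 L × Fin (fundamentalLatticeRep 2).N × Fin (fundamentalLatticeRep 2).N × Bool =>
        if n.1 = q.1 then (fun z : ℂ => if q.2.2.2 then z.im else z.re) (((Real.sqrt 2 : ℂ) • ((fundamentalLatticeRep 2).lieProj (noiseDir n.2) *
          (fundamentalLatticeRep 2).ρ (V q.1))) q.2.1 q.2.2.1) else 0) := by
    funext q
    simp only [hσ, latticeLangevinDynamics_noise]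
    rfl
  rw [sum_apply_single_mul_eq_apply (fderiv ℝ f (coords V)) (fun i => σ i n), hσn, sq]

/-! ## §3. The Lipschitz bound in `ρ_L` from a uniform bound on the carré du champ -/

section Lipschitz

open scoped Matrix.Norms.Operator

/-- ★★★ **From `Γ^A ≤ σ²` to `√(σ²/2)`-Lipschitz in Shen–Zhu–Zhu's metric `ρ_L`.**  Let `f` be a differentiable function of the real link
coordinates whose coordinate carré du champ is bounded on the group, `Γ^A(f)(V) ≤ σ²` for every `V ∈ SU(2)^E`.  Then for all `Q, Q' ∈ SU(2)^E`:
`|f(coords Q') − f(coords Q)| ≤ √(σ²/2) · ρ_L(Q, Q')`, `ρ_L² = torusRiemannDistSq = Σ_e ρ(Q_e,Q'_e)²` (mean value inequality along the minimal product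
geodesic `s ↦ (e^(sX_e) Q_e)_e`, `X_e` the minimal logarithms, `Σ_e |X_e|² = ρ_L²`; `Γ^A = 2|∇·|²` for the Hilbert–Schmidt bi-invariant metric).
[cite: BakryGentilLedoux2014, §1.11 and (3.2.4)] -/
theorem abs_sub_le_sqrt_carre_mul_sqrt_torusRiemannDistSq (L : ℕ) [NeZero L] (β' : ℝ)
    {f : (Edge 3 L × Fin 2 × Fin 2 × Bool → ℝ) → ℝ} (hf : Differentiable ℝ f) {σ2 : ℝ} :
    let coords : GaugeConfig 3 L (Matrix.specialUnitaryGroup (Fin 2) ℂ) → (Edge 3 L × Fin 2 × Fin 2 × Bool → ℝ) :=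
      fun V q => (fun z : ℂ => if q.2.2.2 then z.im else z.re)
        ((fundamentalRep (Fin 2) (V q.1) : Matrix (Fin 2) (Fin 2) ℂ) q.2.1 q.2.2.1)
    let A : GaugeConfig 3 L (Matrix.specialUnitaryGroup (Fin 2) ℂ) → (Edge 3 L × Fin 2 × Fin 2 × Bool) →
        (Edge 3 L × Fin 2 × Fin 2 × Bool) → ℝ := fun V i j =>
      ∑ n : Edge 3 L × NoiseIdx 2,
        (if n.1 = i.1 then (fun z : ℂ => if i.2.2.2 then z.im else z.re)
          ((latticeLangevinDynamics (fundamentalLatticeRep 2) β').noise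
            (matrixConfig (fundamentalRep (Fin 2)) V) i.1 n.2 i.2.1 i.2.2.1) else 0) *
        (if n.1 = j.1 then (fun z : ℂ => if j.2.2.2 then z.im else z.re)
          ((latticeLangevinDynamics (fundamentalLatticeRep 2) β').noise
            (matrixConfig (fundamentalRep (Fin 2)) V) j.1 n.2 j.2.1 j.2.2.1) else 0)
    (∀ y, (∑ i : Edge 3 L × Fin 2 × Fin 2 × Bool, ∑ j : Edge 3 L × Fin 2 × Fin 2 × Bool,
        fderiv ℝ f (coords y) (Pi.single i 1) * fderiv ℝ f (coords y) (Pi.single j 1) * A y i j) ≤ σ2) →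
    ∀ Q Q' : GaugeConfig 3 L (Matrix.specialUnitaryGroup (Fin 2) ℂ),
      |f (coords Q') - f (coords Q)| ≤ Real.sqrt (σ2 / 2) * Real.sqrt (torusRiemannDistSq (fundamentalLatticeRep 2) Q Q') := by
  intro coords A hΓ Q Q'
  classical
  -- minimal logarithms link by link (G40)
  have hlog : ∀ e : Edge 3 L, ∃ X : Matrix (Fin (fundamentalLatticeRep 2).N) (Fin (fundamentalLatticeRep 2).N) ℂ, X ∈ (fundamentalLatticeRep 2).lieAlg ∧
      NormedSpace.exp X * (fundamentalLatticeRep 2).ρ (Q e) = (fundamentalLatticeRep 2).ρ (Q' e) ∧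
      Real.sqrt (hsForm (fundamentalLatticeRep 2).N X X) = (fundamentalLatticeRep 2).riemannDist (Q e) (Q' e) := fun e =>
    exists_mem_lieAlg_exp_mul_eq_sqrt_hsForm_eq_riemannDist (Q e) (Q' e)
  choose X hXmem hXexp hXnorm using hlog
  have hXh : ∀ e, (X e)ᴴ = -(X e) := fun e => by
    rw [← Matrix.star_eq_conjTranspose]; exact (fundamentalLatticeRep 2).star_eq_neg_of_mem_lieAlg (hXmem e)
  have hX0 : ∀ e, (X e).trace = 0 := fun e => trace_eq_zero_of_mem_lieAlg_two (hXmem e)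
  have hsq : ∀ e, hsForm (fundamentalLatticeRep 2).N (X e) (X e) = (fundamentalLatticeRep 2).riemannDist (Q e) (Q' e) ^ 2 := fun e => by
    rw [← hXnorm e, Real.sq_sqrt (hsForm_self_nonneg _)]
  have hdist : ∑ e : Edge 3 L, hsForm (fundamentalLatticeRep 2).N (X e) (X e) = torusRiemannDistSq (fundamentalLatticeRep 2) Q Q' := by
    unfold torusRiemannDistSq; exact Finset.sum_congr rfl fun e _ => hsq e
  -- the product geodesic `γ_s = (e^(sX_e) Q_e)_e`
  set γ : ℝ → GaugeConfig 3 L (Matrix.specialUnitaryGroup (Fin 2) ℂ) := fun s e =>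
    SUNBakryEmery.expSU (N := 2) (Y := Matrix.of fun i j : Fin 2 => X e i j) (hXh e) (hX0 e) s * Q e with hγ
  have hγcoe : ∀ s e, (fundamentalLatticeRep 2).ρ (γ s e) = NormedSpace.exp (s • X e) * (fundamentalLatticeRep 2).ρ (Q e) := fun s e => rfl
  have hγ0 : γ 0 = Q := by
    funext e
    apply Subtype.ext
    change NormedSpace.exp ((0 : ℝ) • X e) * (fundamentalLatticeRep 2).ρ (Q e) = (fundamentalLatticeRep 2).ρ (Q e)
    rw [zero_smul, NormedSpace.exp_zero, Matrix.one_mul]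
  have hγ1 : γ 1 = Q' := by
    funext e
    apply Subtype.ext
    change NormedSpace.exp ((1 : ℝ) • X e) * (fundamentalLatticeRep 2).ρ (Q e) = (fundamentalLatticeRep 2).ρ (Q' e)
    rw [one_smul, hXexp e]
  -- the coordinate map `CO` of matrix configurations and the path in coordinates
  set COf : (Edge 3 L → Matrix (Fin (fundamentalLatticeRep 2).N) (Fin (fundamentalLatticeRep 2).N) ℂ) → (Edge 3 L × Fin 2 × Fin 2 × Bool → ℝ) := fun Mc q =>
    (fun z : ℂ => if q.2.2.2 then z.im else z.re) (Mc q.1 q.2.1 q.2.2.1) with hCOf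
  have hCOadd : ∀ M₁ M₂, COf (M₁ + M₂) = COf M₁ + COf M₂ := by
    intro M₁ M₂; funext q; obtain ⟨e, a, b, flag⟩ := q
    cases flag
    · change ((M₁ e a b) + (M₂ e a b)).re = (M₁ e a b).re + (M₂ e a b).re
      exact Complex.add_re _ _
    · change ((M₁ e a b) + (M₂ e a b)).im = (M₁ e a b).im + (M₂ e a b).im
      exact Complex.add_im _ _
  have hCOsmul : ∀ (t : ℝ) M₁, COf (t • M₁) = t • COf M₁ := by
    intro t M₁; funext q; obtain ⟨e, a, b, flag⟩ := q
    cases flag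
    · change (t • (M₁ e a b)).re = t * (M₁ e a b).re
      rw [Complex.smul_re, smul_eq_mul]
    · change (t • (M₁ e a b)).im = t * (M₁ e a b).im
      rw [Complex.smul_im, smul_eq_mul]
  let COl : (Edge 3 L → Matrix (Fin (fundamentalLatticeRep 2).N) (Fin (fundamentalLatticeRep 2).N) ℂ) →ₗ[ℝ] (Edge 3 L × Fin 2 × Fin 2 × Bool → ℝ) := { toFun := COf, map_add' := hCOadd, map_smul' := hCOsmul }
  let CO : (Edge 3 L → Matrix (Fin (fundamentalLatticeRep 2).N) (Fin (fundamentalLatticeRep 2).N) ℂ) →L[ℝ] (Edge 3 L × Fin 2 × Fin 2 × Bool → ℝ) := LinearMap.toContinuousLinearMap COl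
  have hCO : ∀ Mc, CO Mc = COf Mc := fun _ => rfl
  set P : ℝ → (Edge 3 L → Matrix (Fin (fundamentalLatticeRep 2).N) (Fin (fundamentalLatticeRep 2).N) ℂ) := fun s e => NormedSpace.exp (s • X e) * (fundamentalLatticeRep 2).ρ (Q e) with hP
  set P' : ℝ → (Edge 3 L → Matrix (Fin (fundamentalLatticeRep 2).N) (Fin (fundamentalLatticeRep 2).N) ℂ) := fun s e => X e * NormedSpace.exp (s • X e) * (fundamentalLatticeRep 2).ρ (Q e) with hP'
  have hcoP : ∀ s, coords (γ s) = CO (P s) := fun s => by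
    rw [hCO]; funext q; rfl
  have hPd : ∀ s, HasDerivAt P (P' s) s := fun s =>
    hasDerivAt_pi.2 fun e => (hasDerivAt_exp_smul_const' (𝕂 := ℝ) (X e) s).mul_const _
  -- the derivative of `s ↦ f(coords γ_s)` and its bound
  have hφd : ∀ s, HasDerivAt (fun s => f (coords (γ s))) (fderiv ℝ f (CO (P s)) (CO (P' s))) s := by
    intro s
    have h := (hf (CO (P s))).hasFDerivAt.comp_hasDerivAt s (CO.hasFDerivAt.comp_hasDerivAt s (hPd s))
    have heq : (fun s => f (coords (γ s))) = f ∘ (⇑CO) ∘ P := by funext s; simp only [Function.comp_apply, hcoP]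
    rw [heq]; exact h
  have hbound : ∀ s, |fderiv ℝ f (CO (P s)) (CO (P' s))| ≤ Real.sqrt (σ2 / 2) * Real.sqrt (torusRiemannDistSq (fundamentalLatticeRep 2) Q Q') := by
    intro s
    -- the velocity is the frame-expanded vector of G42 §1 at `V = γ_s`
    have hv : CO (P' s) = fun q : Edge 3 L × Fin 2 × Fin 2 × Bool => (fun z : ℂ => if q.2.2.2 then z.im else z.re)
        ((X q.1 * (fundamentalLatticeRep 2).ρ (γ s q.1)) q.2.1 q.2.2.1) := by
      rw [hCO]; funext q
      simp only [hCOf, hP', hγcoe, Matrix.mul_assoc]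
    have hCS := frame_cauchySchwarz_two (L := L) (γ s) X hXmem (fderiv ℝ f (CO (P s)))
    have hΓs : (∑ i : Edge 3 L × Fin 2 × Fin 2 × Bool, ∑ j : Edge 3 L × Fin 2 × Fin 2 × Bool,
        fderiv ℝ f (coords (γ s)) (Pi.single i 1) * fderiv ℝ f (coords (γ s)) (Pi.single j 1) * A (γ s) i j) =
        ∑ n : Edge 3 L × NoiseIdx (fundamentalLatticeRep 2).N, (fderiv ℝ f (coords (γ s)) (fun q : Edge 3 L × Fin (fundamentalLatticeRep 2).N × Fin (fundamentalLatticeRep 2).N × Bool =>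
          if n.1 = q.1 then (fun z : ℂ => if q.2.2.2 then z.im else z.re) (((Real.sqrt 2 : ℂ) • ((fundamentalLatticeRep 2).lieProj (noiseDir n.2) *
            (fundamentalLatticeRep 2).ρ (γ s q.1))) q.2.1 q.2.2.1) else 0)) ^ 2 := carre_eq_sum_sq_frame_two β' f (γ s)
    have hle : (∑ n : Edge 3 L × NoiseIdx (fundamentalLatticeRep 2).N, (fderiv ℝ f (CO (P s)) (fun q : Edge 3 L × Fin (fundamentalLatticeRep 2).N × Fin (fundamentalLatticeRep 2).N × Bool =>
          if n.1 = q.1 then (fun z : ℂ => if q.2.2.2 then z.im else z.re) (((Real.sqrt 2 : ℂ) • ((fundamentalLatticeRep 2).lieProj (noiseDir n.2) *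
            (fundamentalLatticeRep 2).ρ (γ s q.1))) q.2.1 q.2.2.1) else 0)) ^ 2) ≤ σ2 := by
      rw [← hcoP, ← hΓs]; exact hΓ (γ s)
    have h0 : 0 ≤ ∑ e : Edge 3 L, hsForm (fundamentalLatticeRep 2).N (X e) (X e) := Finset.sum_nonneg fun e _ => hsForm_self_nonneg _
    have hsq2 : (fderiv ℝ f (CO (P s)) (CO (P' s))) ^ 2 ≤ (torusRiemannDistSq (fundamentalLatticeRep 2) Q Q') / 2 * σ2 := by
      rw [hv, ← hdist]
      exact hCS.trans (mul_le_mul_of_nonneg_left hle (by positivity))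
    have hσ0 : 0 ≤ σ2 := le_trans (Finset.sum_nonneg fun n _ => sq_nonneg _) hle
    calc |fderiv ℝ f (CO (P s)) (CO (P' s))| = Real.sqrt ((fderiv ℝ f (CO (P s)) (CO (P' s))) ^ 2) := (Real.sqrt_sq_eq_abs _).symm
      _ ≤ Real.sqrt ((torusRiemannDistSq (fundamentalLatticeRep 2) Q Q') / 2 * σ2) := Real.sqrt_le_sqrt hsq2
      _ = Real.sqrt (σ2 / 2) * Real.sqrt (torusRiemannDistSq (fundamentalLatticeRep 2) Q Q') := by
          rw [← Real.sqrt_mul (by positivity : (0:ℝ) ≤ σ2 / 2)]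
          congr 1; ring
  -- mean value inequality on `[0, 1]`
  have hMV := norm_image_sub_le_of_norm_deriv_le_segment_01' (f := fun s => f (coords (γ s)))
    (f' := fun s => fderiv ℝ f (CO (P s)) (CO (P' s))) (fun s _ => (hφd s).hasDerivWithinAt)
    (fun s _ => by rw [Real.norm_eq_abs]; exact hbound s)
  rw [Real.norm_eq_abs] at hMV
  simpa only [hγ0, hγ1] using hMV

end Lipschitz

end Summit.QuantumFields.YangMills.Theorems.ColdStartUniversality

end
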